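import Literature.AnabelianGeometry.SemiGraphs.TemperedLevelData
import Literature.AnabelianGeometry.SemiGraphs.TreeGeodesics
import Literature.AnabelianGeometry.SemiGraphs.FreeGroupsAndActionsProofs2
import Literature.AnabelianGeometry.SemiGraphs.SubdivisionLemmas
import Literature.AnabelianGeometry.SemiGraphs.MorphismsOver
import HarnessLib

/-!
# Compatible fixed systems from BOUNDED DISTANCE: the nearest-point route ([SemiAnbd] Thm 3.7 (iii), p. 41)

Mochizuki, *Semi-graphs of anabelioids*, Publ. RIMS **42** (2006), §3, Theorem 3.7 (iii), author's
manuscript p. 41 [cite: MochizukiSemiAnbd2006, Thm 3.7(iii) p.41]: "we may assume that there exists a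
compatible system of vertices of `𝒢_{∞,j}`, for `j ∈ J`, each of which is fixed by `H`" — the
hypothesis `hfix` of the cell's finiteness-free route `VerticialLevelData.compactInVerticial_of_fixedSystems`
(abc-iut-L3-t10, `TemperedCompactInVerticialOfFixedSystems.lean`; cell gap G-t6g3-2 «Thm 3.7 (iii)
beyond finite 𝒢»).  Print obtains it from the finiteness of the `𝔾_j`; at an infinite countable `𝔾` the
fixed subtrees can be infinite and an inverse system of nonempty infinite sets may have empty limit.

This PROOF-ONLY file (abc-iut-L3-t6; no definitions) proves the METRIC form of the compatible choice,
valid at every `𝔾`: over the level data `D : VerticialLevelData 𝒢 c` of a chart, if some compatible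
vertex system `x` stays at BOUNDED distance (in the barycentric subdivisions of the trees `D.tree j`)
from vertices fixed by `C`, then `C` fixes a COMPATIBLE vertex system
(`VerticialLevelData.exists_fixedSystem_of_bddDist`).  Mechanism (Serre, *Trees*, I §2, §6.4 — gated
subtrees): the `C`-fixed nodes of each tree form a convex set (`SemiGraph.nodeMap_eq_self_of_isPath`,
abc-iut-L3-t1), so the NEAREST fixed node to `x_j` is unique (`SemiGraph.eq_of_isNearest`, no peaks
along geodesics: `dist_lt_max_of_mem_support`) and is a vertex node because the action is over the base
`𝔾` (no branch switching, `SemiGraph.branchMap_eq_of_over_aut`); the distances `n_j = d_j(x_j, Fix_j C)`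
are non-decreasing in `j` (the transition maps are 1-Lipschitz and carry fixed nodes to fixed nodes),
hence eventually constant when bounded, and then the transitions carry nearest points to nearest points,
i.e. the nearest fixed vertices form a compatible system.  Consequence: the residual (FIX∞).hfix of
G-t6g3-2 is EQUIVALENT to «bounded distance to the fixed sets» (the converse direction is trivial with
bound `0`).  Nothing here bears on [IUTchIII] Cor. 3.12.
-/

namespace Literature.AnabelianGeometry.SemiGraphs

open CategoryTheory Topology

universe v u

namespace SemiGraph

variable {G : SemiGraph.{u}}

/-! ### Distances in the subdivision under morphisms and automorphisms -/

/-- A morphism of semi-graphs is 1-Lipschitz on the barycentric subdivisions (from a connected source):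
walks map to walks of the same length. [cite: MochizukiSemiAnbd2006, §1 p.11] -/
theorem subdivision_dist_map_le (hG : G.IsConnected) {G' : SemiGraph.{u}} (φ : G ⟶ G') (x y : G.Node) :
    G'.subdivision.dist (Sum.map φ.vertexMap (Sum.map φ.edgeMap φ.branchMap) x)
        (Sum.map φ.vertexMap (Sum.map φ.edgeMap φ.branchMap) y) ≤ G.subdivision.dist x y := by
  let f : G.subdivision →g G'.subdivision :=
    { toFun := Sum.map φ.vertexMap (Sum.map φ.edgeMap φ.branchMap)
      map_rel' := fun h => G.subdivision_adj_map φ h }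
  obtain ⟨p, hp⟩ := hG.connected.exists_walk_length_eq_dist x y
  have h := SimpleGraph.dist_le (p.map f)
  rw [SimpleGraph.Walk.length_map, hp] at h
  exact h

/-! ### Nearest points of a convex node set in a tree -/

/-- **Gatedness of convex subsets of a tree**: if a set `P` of nodes of the subdivision of a tree is
convex (contains every node of every path between two of its nodes), then a node of `P` NEAREST to a
given node `o` is unique — two nearest nodes at equal distance would be joined by a path inside `P`
whose interior is strictly closer to `o` (no peaks along a path of a tree), or be adjacent, which the
parity of distances in a tree forbids. (Serre, *Trees*, I §2.) [cite: MochizukiSemiAnbd2006, Lem. 1.8 p.20] -/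
theorem eq_of_isNearest (hG : G.IsTree) {P : G.Node → Prop}
    (hconv : ∀ ⦃x y : G.Node⦄, P x → P y → ∀ (p : G.subdivision.Walk x y), p.IsPath →
      ∀ z ∈ p.support, P z)
    (o : G.Node) {y y' : G.Node} (hy : P y) (hy' : P y')
    (hmin : ∀ z, P z → G.subdivision.dist o y ≤ G.subdivision.dist o z)
    (heq : G.subdivision.dist o y' = G.subdivision.dist o y) : y = y' := by
  by_contra hne
  have hT := hG.isTree
  obtain ⟨p, hp⟩ := hT.1.exists_isPath y y'
  have hl : 0 < p.length := by
    rcases Nat.eq_zero_or_pos p.length with h | h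
    · exact absurd (p.eq_of_length_eq_zero h) hne
    · exact h
  -- the second node of the path
  have hadj : G.subdivision.Adj y (p.getVert 1) := by
    have := p.adj_getVert_succ (i := 0) hl
    simpa using this
  by_cases hz : p.getVert 1 = y'
  · -- `y ~ y'`: distances from `o` differ by one
    rw [hz] at hadj
    rcases hT.dist_eq_dist_add_one_of_adj o hadj with h | h <;> omega
  · have hzy : p.getVert 1 ≠ y := hadj.ne.symm
    have hmem : p.getVert 1 ∈ p.support := p.getVert_mem_support 1
    have hPz : P (p.getVert 1) := hconv hy hy' p hp _ hmem
    have hlt := dist_lt_max_of_mem_support hT o p hp hmem hzy hz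
    have := hmin _ hPz
    rw [heq, max_self] at hlt
    omega

/-! ### Fixed nodes of automorphisms over a base -/

/-- **A nearest fixed node is a vertex node** when the automorphisms are OVER a base `p : G ⟶ H`:
starting from a vertex node `o`, let `y` be a node fixed by the family `ρ` nearest to `o` and `a` its
neighbour towards `o` (not fixed).  If `y` were an edge node, `a` would be one of its branches, fixed
because no automorphism over the base switches branches (`branchMap_eq_of_over_aut`); if `y` were a
branch node, `a` would be its edge or its vertex, both fixed with it.
[cite: MochizukiSemiAnbd2006, Thm 3.7(iii) p.41] -/
theorem isNearest_fixed_is_vertex (hG : G.IsTree) {H : SemiGraph.{u}} (p : G ⟶ H) {ι : Type*}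
    (ρ : ι → Aut G) (hover : ∀ i, (ρ i).hom ≫ p = p) (v₀ : G.Vertex) {y : G.Node}
    (hy : ∀ i, nodeMap (ρ i) y = y)
    (hmin : ∀ z, (∀ i, nodeMap (ρ i) z = z) →
      G.subdivision.dist (Sum.inl v₀) y ≤ G.subdivision.dist (Sum.inl v₀) z) :
    ∃ w : G.Vertex, y = Sum.inl w := by
  have hT := hG.isTree
  by_cases hyo : y = Sum.inl v₀
  · exact ⟨v₀, hyo⟩
  -- a neighbour `a` of `y` strictly closer to `o`, hence not fixed
  obtain ⟨q, hq⟩ := hT.1.exists_walk_length_eq_dist y (Sum.inl v₀)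
  have hqnil : ¬ q.Nil := SimpleGraph.Walk.not_nil_of_ne hyo
  have hadj : G.subdivision.Adj y q.snd := q.adj_snd hqnil
  have hlt : G.subdivision.dist (Sum.inl v₀) q.snd < G.subdivision.dist (Sum.inl v₀) y := by
    have h1 : G.subdivision.dist (Sum.inl v₀) q.snd ≤ q.tail.length := by
      have := SimpleGraph.dist_le q.tail.reverse
      rwa [SimpleGraph.Walk.length_reverse] at this
    have h2 : q.tail.length + 1 = q.length := q.length_tail_add_one hqnil
    rw [SimpleGraph.dist_comm] at hq
    omega
  have hna : ¬ ∀ i, nodeMap (ρ i) q.snd = q.snd := fun h => absurd (hmin _ h) (not_le.mpr hlt)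
  -- case analysis on the type of `y`
  rcases y with w | e | b
  · exact ⟨w, rfl⟩
  · -- edge node: the neighbour is a branch of `e`, fixed by the no-switching lemma
    exfalso
    obtain ⟨b, hbe, hab⟩ := (G.subdivision_adj_edge_iff e q.snd).mp hadj
    apply hna
    intro i
    have he : (ρ i).hom.edgeMap e = e := by
      have := hy i
      simpa [nodeMap] using this
    have hb : (ρ i).hom.branchMap b = b :=
      branchMap_eq_of_over_aut p (ρ i) (hover i) b (by rw [hbe, he])
    rw [hab]
    simp [nodeMap, hb]
  · -- branch node: the neighbour is its edge or its vertex, fixed with `b`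
    exfalso
    apply hna
    intro i
    have hb : (ρ i).hom.branchMap b = b := by
      have := hy i
      simpa [nodeMap] using this
    rcases (G.subdivision_adj_branch_iff b q.snd).mp hadj with hae | ⟨w, hbw, haw⟩
    · rw [hae]
      have he : (ρ i).hom.edgeMap (G.edgeOf b) = G.edgeOf b := by
        rw [← (ρ i).hom.edgeOf_branchMap b, hb]
      simp [nodeMap, he]
    · rw [haw]
      have hw : (ρ i).hom.vertexMap w = w := by
        have h1 := (ρ i).hom.abuts_branchMap b w hbw
        rw [hb, hbw] at h1
        exact (Option.some_injective _ h1).symm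
      simp [nodeMap, hw]

end SemiGraph

namespace ProfiniteSemiGraph

namespace VerticialLevelData

variable {𝒢 : ProfiniteSemiGraph.{u}} {c : TemperedPiChart 𝒢} (D : VerticialLevelData.{v} 𝒢 c)

/-- The transition maps carry nodes fixed by every `g ∈ C` to nodes fixed by every `g ∈ C`
(equivariance `trans_act`). [cite: MochizukiSemiAnbd2006, Thm 3.7(iii) p.41] -/
theorem nodeMap_trans_of_fixed ⦃i j : D.J⦄ (h : i ≤ j) (C : Subgroup c.G) {z : (D.tree j).Node}
    (hz : ∀ g : C, SemiGraph.nodeMap (D.act j g) z = z) (g : C) :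
    SemiGraph.nodeMap (D.act i g)
      (Sum.map (D.trans h).vertexMap (Sum.map (D.trans h).edgeMap (D.trans h).branchMap) z) =
      Sum.map (D.trans h).vertexMap (Sum.map (D.trans h).edgeMap (D.trans h).branchMap) z := by
  have hcomm := D.trans_act h (g : c.G)
  rcases z with w | e | b
  · have hw : (D.act j g).hom.vertexMap w = w := by simpa [SemiGraph.nodeMap] using hz g
    have := congrArg (fun φ => SemiGraph.Hom.vertexMap φ w) hcomm
    simp only [SemiGraph.comp_vertexMap, Function.comp_apply, hw] at this
    simp [SemiGraph.nodeMap, ← this]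
  · have he : (D.act j g).hom.edgeMap e = e := by simpa [SemiGraph.nodeMap] using hz g
    have := congrArg (fun φ => SemiGraph.Hom.edgeMap φ e) hcomm
    simp only [SemiGraph.comp_edgeMap, Function.comp_apply, he] at this
    simp [SemiGraph.nodeMap, ← this]
  · have hb : (D.act j g).hom.branchMap b = b := by simpa [SemiGraph.nodeMap] using hz g
    have := congrArg (fun φ => SemiGraph.Hom.branchMap φ b) hcomm
    simp only [SemiGraph.comp_branchMap, Function.comp_apply, hb] at this
    simp [SemiGraph.nodeMap, ← this]

/-- **Compatible fixed systems from bounded distance** ([SemiAnbd] Thm 3.7 (iii), p. 41 "we may assume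
that there exists a compatible system of vertices of `𝒢_{∞,j}` … each of which is fixed by `H`", in
the finiteness-free METRIC form): over the level data `D` of a chart, let `x` be a compatible vertex
system and `C ≤ c.G` a subgroup such that at every level some `C`-fixed vertex lies within subdivision
distance `N` of `x_j`.  Then `C` fixes a COMPATIBLE vertex system.  Proof: the distance `n_j` from
`x_j` to the (convex) set of `C`-fixed nodes is non-decreasing in `j` and bounded by `N`, hence
eventually constant; from that level on the NEAREST fixed node — unique (`SemiGraph.eq_of_isNearest`), a
vertex (`SemiGraph.isNearest_fixed_is_vertex`) — is carried by the transition maps to the nearest fixed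
node, so these vertices are compatible; below that level one transports them down.  This is the
hypothesis `hfix` of `VerticialLevelData.compactInVerticial_of_fixedSystems` for `C`.
[cite: MochizukiSemiAnbd2006, Thm 3.7(iii) p.41] -/
theorem exists_fixedSystem_of_bddDist (C : Subgroup c.G) (x : ∀ j, (D.tree j).Vertex)
    (hx : ∀ ⦃i j : D.J⦄ (h : i ≤ j), (D.trans h).vertexMap (x j) = x i) (N : ℕ)
    (hN : ∀ j, ∃ y : (D.tree j).Vertex, (∀ g ∈ C, (D.act j g).hom.vertexMap y = y) ∧
      (D.tree j).subdivision.dist (Sum.inl (x j)) (Sum.inl y) ≤ N) :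
    ∃ y : ∀ j, (D.tree j).Vertex, (∀ ⦃i j : D.J⦄ (h : i ≤ j), (D.trans h).vertexMap (y j) = y i) ∧
      ∀ g ∈ C, ∀ j, (D.act j g).hom.vertexMap (y j) = y j := by
  classical
  haveI := D.nonempty
  -- fixed nodes at level `j`, distance from `x j`, transition on nodes
  let Fx : ∀ j, (D.tree j).Node → Prop := fun j z => ∀ g : C, SemiGraph.nodeMap (D.act j g) z = z
  have hFx_vert : ∀ j (y : (D.tree j).Vertex),
      Fx j (Sum.inl y) ↔ ∀ g ∈ C, (D.act j g).hom.vertexMap y = y := fun j y => by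
    simp only [Fx, SemiGraph.nodeMap, Sum.map_inl, Sum.inl.injEq, Subtype.forall]
  let dj : ∀ j, (D.tree j).Node → ℕ := fun j z => (D.tree j).subdivision.dist (Sum.inl (x j)) z
  let T : ∀ ⦃i j : D.J⦄, i ≤ j → (D.tree j).Node → (D.tree i).Node := fun i j h =>
    Sum.map (D.trans h).vertexMap (Sum.map (D.trans h).edgeMap (D.trans h).branchMap)
  have hT_inl : ∀ ⦃i j : D.J⦄ (h : i ≤ j) (w : (D.tree j).Vertex),
      T h (Sum.inl w) = Sum.inl ((D.trans h).vertexMap w) := fun i j h w => rfl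
  have hT_fix : ∀ ⦃i j : D.J⦄ (h : i ≤ j) (z : (D.tree j).Node), Fx j z → Fx i (T h z) :=
    fun i j h z hz g => D.nodeMap_trans_of_fixed h C hz g
  have hT_dist : ∀ ⦃i j : D.J⦄ (h : i ≤ j) (z : (D.tree j).Node), dj i (T h z) ≤ dj j z := by
    intro i j h z
    have := (D.tree j).subdivision_dist_map_le ⟨(D.isTree j).isTree.1⟩ (D.trans h) (Sum.inl (x j)) z
    simpa only [Sum.map_inl, hx h] using this
  -- convexity of the fixed node sets
  have hconv : ∀ j ⦃a b : (D.tree j).Node⦄, Fx j a → Fx j b →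
      ∀ (p : (D.tree j).subdivision.Walk a b), p.IsPath → ∀ w ∈ p.support, Fx j w :=
    fun j a b ha hb p hp w hw g =>
      SemiGraph.nodeMap_eq_self_of_isPath (D.isTree j).isTree.2 (D.act j g) (ha g) (hb g) p hp w hw
  -- the minimal distance `n j` to a fixed node
  have hex : ∀ j, ∃ n, ∃ z, Fx j z ∧ dj j z = n := fun j => by
    obtain ⟨y, hy, -⟩ := hN j
    exact ⟨_, Sum.inl y, (hFx_vert j y).mpr hy, rfl⟩
  let n : D.J → ℕ := fun j => Nat.find (hex j)
  have hn_spec : ∀ j, ∃ z, Fx j z ∧ dj j z = n j := fun j => Nat.find_spec (hex j)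
  have hn_min : ∀ j z, Fx j z → n j ≤ dj j z := fun j z hz =>
    Nat.find_min' (hex j) ⟨z, hz, rfl⟩
  have hn_le : ∀ j, n j ≤ N := fun j => by
    obtain ⟨y, hy, hyN⟩ := hN j
    exact (hn_min j (Sum.inl y) ((hFx_vert j y).mpr hy)).trans hyN
  -- `n` is monotone along the transitions
  have hn_mono : ∀ ⦃i j : D.J⦄, i ≤ j → n i ≤ n j := fun i j h => by
    obtain ⟨z, hz, hzd⟩ := hn_spec j
    exact (hn_min i (T h z) (hT_fix h z hz)).trans (hzd ▸ hT_dist h z)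
  -- `n` attains a maximum `M` at some `j₀`, and is constant above `j₀`
  have hbdd : ∃ M, ∀ j, n j ≤ M := ⟨N, hn_le⟩
  let M := Nat.find hbdd
  have hM : ∀ j, n j ≤ M := Nat.find_spec hbdd
  have hM_att : ∃ j₀, n j₀ = M := by
    by_contra hcon
    have hcon' : ∀ j, n j ≠ M := fun j h => hcon ⟨j, h⟩
    rcases Nat.eq_zero_or_pos M with hM0 | hMpos
    · obtain ⟨j⟩ := D.nonempty
      exact hcon' j (by have := hM j; omega)
    · have h' : ∀ j, n j ≤ M - 1 := fun j => by have := hM j; have := hcon' j; omega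
      have hmin := Nat.find_min' hbdd h'
      omega
  obtain ⟨j₀, hj₀⟩ := hM_att
  have hconst : ∀ ⦃j⦄, j₀ ≤ j → n j = M := fun j h => le_antisymm (hM j) (hj₀ ▸ hn_mono h)
  -- nearest fixed nodes are unique …
  have huniq : ∀ j (z z' : (D.tree j).Node), Fx j z → Fx j z' → dj j z = n j → dj j z' = n j →
      z = z' := fun j z z' hz hz' hzd hz'd =>
    SemiGraph.eq_of_isNearest (D.isTree j) (hconv j) (Sum.inl (x j)) hz hz'
      (fun w hw => by rw [show (D.tree j).subdivision.dist (Sum.inl (x j)) z = n j from hzd]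
                      exact hn_min j w hw)
      (by rw [show (D.tree j).subdivision.dist (Sum.inl (x j)) z' = n j from hz'd]; exact hzd.symm)
  -- … and are vertex nodes (the action is over `𝔾`)
  have hvert : ∀ j (z : (D.tree j).Node), Fx j z → dj j z = n j → ∃ w, z = Sum.inl w :=
    fun j z hz hzd =>
      SemiGraph.isNearest_fixed_is_vertex (D.isTree j) (D.proj j) (fun g : C => D.act j g)
        (fun g => D.act_over j g) (x j) hz
        (fun w hw => by rw [show (D.tree j).subdivision.dist (Sum.inl (x j)) z = n j from hzd]
                        exact hn_min j w hw)
  -- the nearest fixed vertex `nv j` at every level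
  have hnv : ∀ j, ∃ w : (D.tree j).Vertex, Fx j (Sum.inl w) ∧ dj j (Sum.inl w) = n j := fun j => by
    obtain ⟨z, hz, hzd⟩ := hn_spec j
    obtain ⟨w, rfl⟩ := hvert j z hz hzd
    exact ⟨w, hz, hzd⟩
  choose nv hnv_fix hnv_dist using hnv
  -- above `j₀` the transitions carry nearest points to nearest points
  have htrans_nv : ∀ ⦃i j : D.J⦄ (h : i ≤ j), j₀ ≤ i → (D.trans h).vertexMap (nv j) = nv i := by
    intro i j h hi
    have hfix' : Fx i (T h (Sum.inl (nv j))) := hT_fix h _ (hnv_fix j)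
    have hd : dj i (T h (Sum.inl (nv j))) = n i := by
      refine le_antisymm ?_ (hn_min i _ hfix')
      have h1 := hT_dist h (Sum.inl (nv j))
      rw [hnv_dist j, hconst (hi.trans h)] at h1
      rwa [hconst hi]
    have := huniq i _ _ hfix' (hnv_fix i) hd (hnv_dist i)
    rw [hT_inl] at this
    exact Sum.inl_injective this
  -- transport down from a common upper level
  have hk : ∀ i : D.J, ∃ k, i ≤ k ∧ j₀ ≤ k := fun i => exists_ge_ge i j₀
  choose k hk_ge hk_j₀ using hk
  refine ⟨fun i => (D.trans (hk_ge i)).vertexMap (nv (k i)), fun i i' h => ?_, fun g hg i => ?_⟩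
  · -- compatibility: compare both sides at a common upper bound `m` of `k i`, `k i'`
    obtain ⟨m, hm, hm'⟩ := exists_ge_ge (k i) (k i')
    show (D.trans h).vertexMap ((D.trans (hk_ge i')).vertexMap (nv (k i'))) =
      (D.trans (hk_ge i)).vertexMap (nv (k i))
    rw [D.trans_vertexMap_comp, ← htrans_nv hm (hk_j₀ i), ← htrans_nv hm' (hk_j₀ i'),
      D.trans_vertexMap_comp, D.trans_vertexMap_comp]
  · -- fixedness is transported by equivariance
    have hfix := (hFx_vert (k i) (nv (k i))).mp (hnv_fix (k i)) g hg
    rw [← D.trans_act_vertexMap, hfix]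

end VerticialLevelData

end ProfiniteSemiGraph

end Literature.AnabelianGeometry.SemiGraphs
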